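import Summits.ResolutionOfSingularities.ResolutionOfSingularities.Theses.WildQuotients
import Literature.AlgebraicGeometry.Resolution.AlterationsPurelyInseparable
import HarnessLib

/-!
# `WildQuotients.GaloisReduction` (stmt-ResolutionOfSingularities-15641) — the composition step

Route `ResolutionOfSingularities/WildQuotients`, support item `GaloisReduction`:

  `GaloisReduction := WildQuotientResolution → Pialt`.

The item is de Jong's REDUCTION: for `X` integral separated of finite type over a field `k` of
characteristic `p`, take de Jong's Galois alteration `X′` (regular, a finite group `G` acting) with
its quotient `X₁ = X′/G`, so that `φ : X₁ → X` is a purely inseparable alteration (de Jong 1997,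
Thm. 5.13 / Cor. 5.15; Abramovich–Oort 2000, Cor. 2.9); resolve `X₁` by `WildQuotientResolution`;
compose. The existential content (the data `X′, X₁, q, φ, G, ρ`) is filed on the route as the
separate support `GaloisQuotientAlteration` (stmt-ResolutionOfSingularities-16323). This file proves
the remaining, purely compositional, half — prime by prime, in the per-prime shape consumed by the
crux `SummitReduction` and by pAlteration's proved frame `Theorems.hasResolution_of_thesis`, and
then globally:

* `pialtAt_of_galoisQuotientAlterationAt` — at a fixed prime `p`: the body of
  `GaloisQuotientAlteration` at `p` and the body of `WildQuotientResolution` at `p` give the body of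
  `Pialt` at `p`;
* `galoisReduction_of_galoisQuotientAlteration : GaloisQuotientAlteration → GaloisReduction`.

Proof: given `X`, `GaloisQuotientAlteration` supplies `q : X′ → X₁`, `φ : X₁ → X`, `G`, `ρ` with
exactly the hypotheses of `WildQuotientResolution` (over `φ ≫ f : X₁ → Spec k`), whence a resolution
`π : X₂ → X₁`; a resolution of the integral `X₁` is a purely inseparable alteration
(`IsResolution.isPurelyInseparableAlteration`, Temkin 2013 §1 (i) ⊂ (iii)), `φ` is one by
hypothesis, and purely inseparable alterations compose (`IsPurelyInseparableAlteration.comp`,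
de Jong 1996, 2.20): `π ≫ φ : X₂ → X` is proper, surjective, with `X₂` integral and regular, finite
and radicial over a dense open of `X` — the conclusion of `Pialt`.
-/

-- single-problem summit: the doubled namespace component `ResolutionOfSingularities` is forced
set_option linter.dupNamespace false

open CategoryTheory AlgebraicGeometry

namespace Summit.ResolutionOfSingularities.ResolutionOfSingularities.Theorems

open Literature.AlgebraicGeometry.Resolution

/-- **The de Jong reduction at a fixed prime `p`, compositional half**: if every integral separated
finite-type `X` over a field of characteristic `p` receives `φ : X₁ → X` proper, surjective, finite
and radicial over a dense open, from a Galois-type quotient `X₁` of a regular integral `X′` (the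
body of `GaloisQuotientAlteration` at `p`; de Jong 1997 Thm. 5.13 / Cor. 5.15), and every such
quotient has a resolution (the body of `WildQuotientResolution` at `p`), then every such `X` has a
purely inseparable regular alteration (the body of `Pialt` at `p`): resolve `X₁` by `π : X₂ → X₁`
and compose — a resolution is a purely inseparable alteration and these compose (de Jong 1996,
2.20). Stated with the route bodies verbatim so that `SummitReduction`'s prover can feed it to
`Theorems.hasResolution_of_thesis`. [cite: DeJong1996, 2.20] -/
theorem pialtAt_of_galoisQuotientAlterationAt {p : ℕ}
    (hGQA : ∀ (k : Type) [Field k] [CharP k p] (X : Scheme.{0}) (f : X ⟶ Spec (.of k)),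
      IsSeparated f → LocallyOfFiniteType f → QuasiCompact f → IsIntegral X →
      ∃ (X' X₁ : Scheme.{0}) (q : X' ⟶ X₁) (φ : X₁ ⟶ X) (G : Type) (_ : Group G) (_ : Finite G)
        (ρ : G →* Aut X'), IsSeparated (φ ≫ f) ∧ LocallyOfFiniteType (φ ≫ f) ∧
        QuasiCompact (φ ≫ f) ∧ IsIntegral X₁ ∧ IsIntegral X' ∧ Scheme.IsRegular X' ∧ IsFinite q ∧
        Function.Surjective q.base ∧ (∃ U : X₁.Opens, Dense (U : Set X₁) ∧ Etale (q ∣_ U)) ∧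
        (∀ g : G, (ρ g).hom ≫ q = q) ∧ (∀ x y : X', q.base x = q.base y → ∃ g : G,
          (ρ g).hom.base x = y) ∧ IsProper φ ∧ Function.Surjective φ.base ∧
        ∃ V : X.Opens, Dense (V : Set X) ∧ IsFinite (φ ∣_ V) ∧ UniversallyInjective (φ ∣_ V))
    (hWQ : ∀ (k : Type) [Field k] [CharP k p] (X' X₁ : Scheme.{0}) (f : X₁ ⟶ Spec (.of k))
      (q : X' ⟶ X₁) (G : Type) [Group G] [Finite G] (ρ : G →* Aut X'),
      IsSeparated f → LocallyOfFiniteType f → QuasiCompact f → IsIntegral X₁ → IsIntegral X' →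
      Scheme.IsRegular X' → IsFinite q → Function.Surjective q.base →
      (∃ U : X₁.Opens, Dense (U : Set X₁) ∧ Etale (q ∣_ U)) → (∀ g : G, (ρ g).hom ≫ q = q) →
      (∀ x y : X', q.base x = q.base y → ∃ g : G, (ρ g).hom.base x = y) →
      Scheme.HasResolution X₁)
    (k : Type) [Field k] [CharP k p] (X : Scheme.{0}) (f : X ⟶ Spec (.of k)) (hs : IsSeparated f)
    (hl : LocallyOfFiniteType f) (hq : QuasiCompact f) (hi : IsIntegral X) :
    ∃ (X' : Scheme.{0}) (g : X' ⟶ X), IsProper g ∧ IsIntegral X' ∧ Scheme.IsRegular X' ∧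
      Function.Surjective g.base ∧
      ∃ U : X.Opens, Dense (U : Set X) ∧ IsFinite (g ∣_ U) ∧ UniversallyInjective (g ∣_ U) := by
  obtain ⟨X', X₁, q, φ, G, _, _, ρ, hs₁, hl₁, hq₁, hi₁, hi', hreg', hfin, hsurj, hU, hinv, horb,
    hφp, hφs, V, hV, hVfin, hVui⟩ := hGQA k X f hs hl hq hi
  -- resolve the quotient `X₁` by `WildQuotientResolution` at `p`
  have hres : Scheme.HasResolution X₁ :=
    hWQ k X' X₁ (φ ≫ f) q G ρ hs₁ hl₁ hq₁ hi₁ hi' hreg' hfin hsurj hU hinv horb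
  obtain ⟨X₂, π, hπ⟩ := hres
  haveI : IsIntegral X₁ := hi₁
  haveI : IsIntegral X := hi
  -- `φ` is a purely inseparable alteration, and so is the resolution `π`; compose
  have hφ : IsPurelyInseparableAlteration φ :=
    { isIntegral := hi₁
      isProper := hφp
      isDominant := ⟨hφs.denseRange⟩
      exists_isFinite_universallyInjective := ⟨V, hV.nonempty, hVfin, hVui⟩ }
  have hcomp : IsPurelyInseparableAlteration (π ≫ φ) := hπ.isPurelyInseparableAlteration.comp hφ
  haveI := hcomp.isProper
  haveI := hcomp.surjective
  obtain ⟨W, hW, hWfin, hWui⟩ := hcomp.exists_dense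
  exact ⟨X₂, π ≫ φ, inferInstance, hcomp.isIntegral, hπ.isRegular, (π ≫ φ).surjective,
    W, hW, hWfin, hWui⟩

/-- **The de Jong reduction, compositional half** (stmt-ResolutionOfSingularities-15641 modulo
stmt-ResolutionOfSingularities-16323): if every integral variety `X` over a field of characteristic
`p` receives a purely inseparable alteration `φ : X₁ → X` from a Galois-type quotient `X₁ = X′/G` of
a regular integral `X′` (`GaloisQuotientAlteration`, de Jong 1997 Thm. 5.13 / Cor. 5.15), then
resolution of such quotients (`WildQuotientResolution`) implies purely inseparable regular
alterations for every `X` (`Pialt`), prime by prime (`pialtAt_of_galoisQuotientAlterationAt`).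
[cite: DeJong1997, Cor. 5.15] -/
theorem galoisReduction_of_galoisQuotientAlteration
    (hGQA : Theses.WildQuotients.GaloisQuotientAlteration) :
    Theses.WildQuotients.GaloisReduction := by
  unfold Theses.WildQuotients.GaloisReduction Theses.WildQuotients.Pialt
  intro hWQ p hp
  exact pialtAt_of_galoisQuotientAlterationAt (hGQA p hp) (hWQ p hp)

end Summit.ResolutionOfSingularities.ResolutionOfSingularities.Theorems
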